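import Summits.CriticalPhenomena.PercolationContinuityZ3.Theorems.PercNearOneGluingNoHeavyLowerTailSurplusTransferPairTools
import Summits.CriticalPhenomena.PercolationContinuityZ3.Theorems.PercNearOneGluingAdditiveGluingSurplusTransfer
import HarnessLib

/-!
# Crux `NoHeavyLowerTail` (stmt-CriticalPhenomena-4575): the surplus-transfer inequality (S5) for TWO relays
# splits termwise; all pieces but one are proved here, the last one is the conditional covariance transfer (COV-Π)

Support file (`--supports stmt-CriticalPhenomena-4575`, prim-hp-4 gen 9).  No named facts, no sorries, no `Prop` definitions.

Setting: `μ = prodBernoulli w`, `F` monotone nonnegative on vertex sets, relays `a, b` with `m_a ≤ m_b`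
(`m_x = ∫ F(C(x))`), an observer `o` and a second observer `v`; `Q = {a ↮ b}`, `D = {v ↮ a} ∩ {v ↮ b}`,
`Xa = {x ↔ a}`, `Xb = {x ↔ b}` for `x ∈ {o, v}`.  The (GEN)-surplus of `x` over `T = {a, b}` is
`Sur_x = ∫_{Xa ∪ Xb} F(C(x)) − μ(Xa)·m_a − μ(Xb ∖ Xa)·m_b`, and the surplus-transfer inequality of the sister crux file
`…AdditiveGluingSurplusTransfer.lean` (lead prim-png-lead-4576) is (S5)₂: `μ(D ∩ {o ↔ v})·Sur_v ≤ μ(D)·Sur_o`.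
(S5)₂ ⟹ (GEN) for three relays (`AGloc.gen_triple_of_surplusTransfer_pair`) ⟹ Kozma–Nitzan's Conjecture 1 for `|A| = 3`.

THE SPLIT (exact identity, `surplus_split`):
  `μ(Q)·Sur_x = μ(Q)·SH_x + S15_x + (m_b − m_a)·μ(Qᶜ)·μ(Xb ∩ Q)`,
  `SH_x  = ∫_{Xa ∪ Xb} F(C(a)) − μ(Xa ∪ Xb)·m_a`                        (Harris piece for the block `{a,b}`),
  `S15_x = μ(Q)·∫_{Xb ∩ Q} (F(C(b)) − F(C(a))) − μ(Xb ∩ Q)·∫_Q (F(C(b)) − F(C(a)))`   (BHK Thm-1.5 piece),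
and each piece transfers from `v` to `o` with the factor of (S5)₂:
* `ordTransfer` (T4):         `μ(D ∩ {o↔v})·μ(Vb ∩ Q) ≤ μ(D)·μ(Ob ∩ Q)`                 — BHK Thm 1.5 (sets) twice;
* `blockHarrisTransfer` (T1): `μ(D ∩ {o↔v})·SH_v ≤ μ(D)·SH_o`                           — Harris on `{o ↔ {a,b,v}}` + BHK two-SET
  association (`S = {v}`, `T = {a,b}`: given `v ↮ {a,b}`, `1{o ∈ C_v}` and `F(C(a))` are negatively correlated);
* `sep_openConn_posCorr` (α): `μ(D ∩ Q)·μ(D ∩ {o↔v}) ≤ μ(D)·μ(D ∩ Q ∩ {o↔v})`;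
* `plusPiece_nonneg`:         `0 ≤ S15_v`                                                — BHK Thm 1.5.
Hence (`surplusTransfer_pair_of_plusTransfer`) (S5)₂ follows from the ONE remaining transfer
  (♠) `μ(D ∩ Q ∩ {o↔v})·S15_v ≤ μ(D ∩ Q)·S15_o`,
the instance `h = F(C(b)) − F(C(a))` of the conditional covariance transfer "COV-Π" of the sister line prim-gen-induct
(`Cov_Q(h, 1{o ∈ C_b}) ≥ Q(o ↔ v | v ↮ a, v ↮ b)·Cov_Q(h, 1{v ∈ C_b})` under `Q = μ(· | a ↮ b)`, for `h` increasing in `C_b`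
and decreasing in `C_a`), census-validated (0 violations in > 10⁶ exact instances of several seats) and open.  Corollaries:
`gen_triple_of_plusTransfer` ((GEN) for three relays from (♠)) and `kn_conj1_three_of_plusTransfer` (Kozma–Nitzan's Conjecture 1
for three relays from (♠) at `F = 1{b' ∈ ·}`).
[cite: VandenbergHaggstromKahn2005, Thms. 1.3–1.5 (pp. 6–8), Thm. 2.1 (p. 9), Remark 1 (p. 5)] [cite: KozmaNitzan2024, Conj. 1 (p. 3), Conj. 4 (p. 32)]
-/

noncomputable section

namespace Summit.CriticalPhenomena.PercolationContinuityZ3.Theorems.SurplusTransfer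

open MeasureTheory Set
open Literature.Probability.LatticeModels (prodBernoulli)
open Literature.Probability.Percolation Literature.Probability.Percolation.KNPreFKG
open Literature.Probability.Percolation.TwoSetExchange

variable {V : Type*}

section Measure

variable [Fintype V]

/-! ## (S5)₂ from the one remaining transfer (♠) -/

/-- **(S5)₂ from the transfer of the (+)-type piece.**  For `F` monotone nonnegative on vertex sets, relays `a, b` with
`m_a ≤ m_b`, an observer `o` and a second observer `v ≠ a, b`, ASSUME the transfer (♠)
`μ(D ∩ Q ∩ {o↔v})·S15_v ≤ μ(D ∩ Q)·S15_o` (`Q = {a ↮ b}`, `D = {v ↮ a} ∩ {v ↮ b}`,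
`S15_x = μ(Q)·∫_{{x↔b}∩Q} (F(C(b)) − F(C(a))) − μ({x↔b} ∩ Q)·∫_Q (F(C(b)) − F(C(a)))` — the instance `h = F(C_b) − F(C_a)` of the
conditional covariance transfer COV-Π).  THEN the surplus-transfer inequality (S5) holds for `T = {a, b}`:
`μ(D ∩ {o↔v})·Sur_v ≤ μ(D)·Sur_o`, `Sur_x = ∫_{x↔a ∨ x↔b} F(C(x)) − (μ(x↔a)·m_a + μ(x↔b, x↮a)·m_b)` — literally the hypothesis
`hS5` of `AGloc.gen_triple_of_surplusTransfer_pair` with `(a₁, a₂, a₃) = (a, b, v)`.  Proof: the split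
`μ(Q)·Sur_x = μ(Q)·SH_x + S15_x + (m_b − m_a)·μ(Qᶜ)·μ({x↔b} ∩ Q)` and the proved transfers `blockHarrisTransfer`, `ordTransfer`,
`sep_openConn_posCorr`, `plusPiece_nonneg`; the degenerate cases `μ(Q) = 0` / `μ(D ∩ Q) = 0` by Harris for the decreasing events `D, Q`,
and `a = b` is `AGloc.surplusTransfer_single`.
[cite: VandenbergHaggstromKahn2005, Thms. 1.3–1.5 (pp. 6–8), Thm. 2.1 (p. 9)] [cite: KozmaNitzan2024, Conj. 4 (p. 32)] -/
theorem surplusTransfer_pair_of_plusTransfer (w : Sym2 V → unitInterval) (o v a b : V) (hva : v ≠ a) (hvb : v ≠ b)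
    (F : Set V → ℝ) (hF : ∀ S T : Set V, S ⊆ T → F S ≤ F T) (hF0 : ∀ S, 0 ≤ F S)
    (hmab : ∫ ω, F (openCluster ω a) ∂(prodBernoulli w) ≤ ∫ ω, F (openCluster ω b) ∂(prodBernoulli w))
    (hUT : (prodBernoulli w).real (({ω : BondConfig V | ¬ (openGraph ω).Reachable v a} ∩ {ω | ¬ (openGraph ω).Reachable v b}) ∩
              (openConn a b)ᶜ ∩ openConn o v) *
        ((prodBernoulli w).real ((openConn a b)ᶜ : Set (BondConfig V)) *
            ∫ ω in (openConn v b ∩ (openConn a b)ᶜ : Set (BondConfig V)), (F (openCluster ω b) - F (openCluster ω a)) ∂(prodBernoulli w) -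
          (prodBernoulli w).real (openConn v b ∩ (openConn a b)ᶜ : Set (BondConfig V)) *
            ∫ ω in ((openConn a b)ᶜ : Set (BondConfig V)), (F (openCluster ω b) - F (openCluster ω a)) ∂(prodBernoulli w)) ≤
      (prodBernoulli w).real (({ω : BondConfig V | ¬ (openGraph ω).Reachable v a} ∩ {ω | ¬ (openGraph ω).Reachable v b}) ∩
              (openConn a b)ᶜ) *
        ((prodBernoulli w).real ((openConn a b)ᶜ : Set (BondConfig V)) *
            ∫ ω in (openConn o b ∩ (openConn a b)ᶜ : Set (BondConfig V)), (F (openCluster ω b) - F (openCluster ω a)) ∂(prodBernoulli w) -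
          (prodBernoulli w).real (openConn o b ∩ (openConn a b)ᶜ : Set (BondConfig V)) *
            ∫ ω in ((openConn a b)ᶜ : Set (BondConfig V)), (F (openCluster ω b) - F (openCluster ω a)) ∂(prodBernoulli w))) :
    (prodBernoulli w).real ({ω : BondConfig V | ¬ (openGraph ω).Reachable v a} ∩
          {ω : BondConfig V | ¬ (openGraph ω).Reachable v b} ∩ openConn o v) *
        (∫ ω in (openConn v a ∪ openConn v b), F (openCluster ω v) ∂(prodBernoulli w) -
          ((prodBernoulli w).real (openConn v a) * ∫ ω, F (openCluster ω a) ∂(prodBernoulli w) +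
            (prodBernoulli w).real (openConn v b ∩ (openConn v a)ᶜ : Set (BondConfig V)) *
              ∫ ω, F (openCluster ω b) ∂(prodBernoulli w))) ≤
      (prodBernoulli w).real ({ω : BondConfig V | ¬ (openGraph ω).Reachable v a} ∩
          {ω : BondConfig V | ¬ (openGraph ω).Reachable v b}) *
        (∫ ω in (openConn o a ∪ openConn o b), F (openCluster ω o) ∂(prodBernoulli w) -
          ((prodBernoulli w).real (openConn o a) * ∫ ω, F (openCluster ω a) ∂(prodBernoulli w) +
            (prodBernoulli w).real (openConn o b ∩ (openConn o a)ᶜ : Set (BondConfig V)) *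
              ∫ ω, F (openCluster ω b) ∂(prodBernoulli w))) := by
  classical
  have hmeas : ∀ T : Set (BondConfig V), MeasurableSet T := fun _ => MeasurableSet.of_discrete
  -- the case `a = b` is (S5)₁
  by_cases hab : a = b
  · subst hab
    have h1 := AGloc.surplusTransfer_single w o v a hva F hF hF0
    have hI : ∀ x : V, ∫ ω in openConn x a, F (openCluster ω x) ∂(prodBernoulli w) =
        ∫ ω in openConn x a, F (openCluster ω a) ∂(prodBernoulli w) := fun x =>
      setIntegral_congr_fun (hmeas _) fun ω hω => by
        show F (openCluster ω x) = F (openCluster ω a)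
        rw [openCluster_eq_of_reachable (hω : (openGraph ω).Reachable x a)]
    rw [inter_self, union_self, union_self, inter_compl_self, inter_compl_self, hI, hI]
    simp only [measureReal_empty, zero_mul, add_zero]
    exact h1
  -- the four proved transfers / signs (stated before the abbreviations, so that `set` rewrites them too)
  have hT1 := blockHarrisTransfer w o v a b F hF hF0
  have hT4 := ordTransfer w o v a b
  have hα := sep_openConn_posCorr w o v a b
  rw [openConn_symm v o] at hα
  have hpos := plusPiece_nonneg w v a b hab F hF
  have hHar : (prodBernoulli w).real ({ω : BondConfig V | ¬ (openGraph ω).Reachable v a} ∩ {ω | ¬ (openGraph ω).Reachable v b}) *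
      (prodBernoulli w).real ((openConn a b)ᶜ : Set (BondConfig V)) ≤
      (prodBernoulli w).real (({ω : BondConfig V | ¬ (openGraph ω).Reachable v a} ∩ {ω | ¬ (openGraph ω).Reachable v b}) ∩
        (openConn a b)ᶜ) :=
    Literature.Probability.LatticeModels.prodBernoulli_harris_lower w
      (((isUpperSet_openConn v a).compl).inter (isUpperSet_openConn v b).compl) (isUpperSet_openConn a b).compl
      (hmeas _) (hmeas _)
  set μ := prodBernoulli w with hμ
  set fa : BondConfig V → ℝ := fun ω => F (openCluster ω a) with hfa
  set fb : BondConfig V → ℝ := fun ω => F (openCluster ω b) with hfb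
  set ma : ℝ := ∫ ω, fa ω ∂μ with hma
  set mb : ℝ := ∫ ω, fb ω ∂μ with hmb
  have hint : ∀ (k : BondConfig V → ℝ) (T : Set (BondConfig V)), IntegrableOn k T μ :=
    fun k T => (Integrable.of_finite).integrableOn
  have hn := fun (S : Set (BondConfig V)) => (measureReal_nonneg : 0 ≤ μ.real S)
  set D : Set (BondConfig V) := {ω | ¬ (openGraph ω).Reachable v a} ∩ {ω | ¬ (openGraph ω).Reachable v b} with hD
  set Qc : Set (BondConfig V) := (openConn a b)ᶜ with hQc
  set Ov : Set (BondConfig V) := openConn o v with hOv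
  -- cluster identities
  have hXbQ : ∀ x : V, (openConn x b ∩ (openConn x a)ᶜ : Set (BondConfig V)) = openConn x b ∩ Qc := by
    intro x; ext ω
    simp only [mem_inter_iff, mem_compl_iff, openConn, mem_setOf_eq, hQc]
    constructor
    · rintro ⟨hxb, hxa⟩; exact ⟨hxb, fun h => hxa (hxb.trans h.symm)⟩
    · rintro ⟨hxb, hq⟩; exact ⟨hxb, fun hxa => hq (hxa.symm.trans hxb)⟩
  have hdiff : ∀ x : V, (openConn x a ∪ openConn x b : Set (BondConfig V)) \ openConn x a = openConn x b ∩ Qc := by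
    intro x; rw [← hXbQ x]; ext ω
    simp only [mem_sdiff, mem_union, mem_inter_iff, mem_compl_iff]; tauto
  -- `Sur_x` in terms of `fa`, `fb`
  have hSur : ∀ x : V, ∫ ω in (openConn x a ∪ openConn x b), F (openCluster ω x) ∂μ =
      ∫ ω in openConn x a, fa ω ∂μ + ∫ ω in openConn x b ∩ Qc, fb ω ∂μ := by
    intro x
    rw [← integral_inter_add_sdiff (hmeas (openConn x a)) (hint _ _), inter_eq_right.2 subset_union_left, hdiff x]
    congr 1
    · exact setIntegral_congr_fun (hmeas _) fun ω hω => by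
        show F (openCluster ω x) = F (openCluster ω a)
        rw [openCluster_eq_of_reachable (hω : (openGraph ω).Reachable x a)]
    · exact setIntegral_congr_fun (hmeas _) fun ω hω => by
        show F (openCluster ω x) = F (openCluster ω b)
        rw [openCluster_eq_of_reachable (hω.1 : (openGraph ω).Reachable x b)]
  -- `SH_x` in terms of `fa`
  have hSH : ∀ x : V, ∫ ω in (openConn x a ∪ openConn x b), fa ω ∂μ =
      ∫ ω in openConn x a, fa ω ∂μ + ∫ ω in openConn x b ∩ Qc, fa ω ∂μ := by
    intro x
    rw [← integral_inter_add_sdiff (hmeas (openConn x a)) (hint _ _), inter_eq_right.2 subset_union_left, hdiff x]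
  have hUμ : ∀ x : V, μ.real (openConn x a ∪ openConn x b : Set (BondConfig V)) = μ.real (openConn x a) + μ.real (openConn x b ∩ Qc) := by
    intro x
    rw [← measureReal_inter_add_sdiff (s := (openConn x a ∪ openConn x b : Set (BondConfig V))) (h := measure_ne_top _ _)
      (hmeas (openConn x a)), inter_eq_right.2 subset_union_left, hdiff x]
  -- `∫_{Qc} (fb - fa) = mb - ma`
  have hQint : ∫ ω in Qc, (fb ω - fa ω) ∂μ = mb - ma := by
    have h1 := integral_add_compl (hmeas (openConn a b : Set (BondConfig V))) (Integrable.of_finite (f := fun ω => fb ω - fa ω) (μ := μ))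
    have h2 : ∫ ω in (openConn a b : Set (BondConfig V)), (fb ω - fa ω) ∂μ = 0 := by
      refine (setIntegral_congr_fun (hmeas _) (g := fun _ => (0 : ℝ)) fun ω hω => ?_).trans (by simp)
      show F (openCluster ω b) - F (openCluster ω a) = 0
      rw [openCluster_eq_of_reachable (hω : (openGraph ω).Reachable a b), sub_self]
    rw [h2, zero_add] at h1
    rw [hQc, h1, integral_sub (Integrable.of_finite) (Integrable.of_finite)]
  have hsubint : ∀ S : Set (BondConfig V), ∫ ω in S, (fb ω - fa ω) ∂μ = ∫ ω in S, fb ω ∂μ - ∫ ω in S, fa ω ∂μ :=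
    fun S => integral_sub (hint fb S) (hint fa S)
  have hmab' : ma ≤ mb := hmab
  have hQc1 : μ.real Qc ≤ 1 := measureReal_le_one
  -- rewrite everything in terms of the pieces
  rw [hSur v, hSur o, hXbQ v, hXbQ o]
  rw [hSH v, hSH o, hUμ v, hUμ o] at hT1
  rw [hQint, hsubint, hsubint] at hUT
  rw [hQint, hsubint] at hpos
  have hQcOv : D ∩ (Qc ∩ Ov) = D ∩ Qc ∩ Ov := (inter_assoc _ _ _).symm
  rw [hQcOv] at hα
  -- real arithmetic
  set P := μ.real Qc with hP
  set d := μ.real D with hd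
  set dov := μ.real (D ∩ Ov) with hdov
  set dq := μ.real (D ∩ Qc) with hdq
  set dqov := μ.real (D ∩ Qc ∩ Ov) with hdqov
  set IaO := ∫ ω in openConn o a, fa ω ∂μ
  set IaV := ∫ ω in openConn v a, fa ω ∂μ
  set IbO := ∫ ω in openConn o b ∩ Qc, fb ω ∂μ with hIbO
  set IbV := ∫ ω in openConn v b ∩ Qc, fb ω ∂μ with hIbV
  set JaO := ∫ ω in openConn o b ∩ Qc, fa ω ∂μ with hJaO
  set JaV := ∫ ω in openConn v b ∩ Qc, fa ω ∂μ with hJaV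
  set xO := μ.real (openConn o b ∩ Qc) with hxO'
  set xV := μ.real (openConn v b ∩ Qc) with hxV'
  set yO := μ.real (openConn o a : Set (BondConfig V))
  set yV := μ.real (openConn v a : Set (BondConfig V))
  -- s15 pieces
  set sO := P * (IbO - JaO) - xO * (mb - ma) with hsO
  set sV := P * (IbV - JaV) - xV * (mb - ma) with hsV
  have hsV0 : 0 ≤ sV := by rw [hsV]; linarith [hpos]
  have hkey : dov * sV ≤ d * sO := by
    -- `dq·(dov sV) ≤ d·dqov·sV ≤ d·dq·sO`
    have e1 : dq * dov * sV ≤ d * dqov * sV := mul_le_mul_of_nonneg_right hα hsV0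
    have e2 : d * (dqov * sV) ≤ d * (dq * sO) := mul_le_mul_of_nonneg_left hUT (hn D)
    have e3 : dq * (dov * sV) ≤ dq * (d * sO) :=
      calc dq * (dov * sV) = dq * dov * sV := by ring
        _ ≤ d * dqov * sV := e1
        _ = d * (dqov * sV) := by ring
        _ ≤ d * (dq * sO) := e2
        _ = dq * (d * sO) := by ring
    by_cases hdq0 : dq = 0
    · -- then `d = 0` or `P = 0`
      have hdP : d * P ≤ 0 := by rw [← hdq0]; exact hHar
      rcases (mul_eq_zero.1 (le_antisymm hdP (mul_nonneg (hn _) (hn _)))) with hd0 | hP0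
      · have hdov0 : dov = 0 := le_antisymm (hd0 ▸ measureReal_mono inter_subset_left (measure_ne_top _ _)) (hn _)
        rw [hdov0, hd0, zero_mul, zero_mul]
      · have hxO : xO = 0 := le_antisymm (hP0 ▸ measureReal_mono inter_subset_right (measure_ne_top _ _)) (hn _)
        have hxV : xV = 0 := le_antisymm (hP0 ▸ measureReal_mono inter_subset_right (measure_ne_top _ _)) (hn _)
        have h3 : sO = 0 := by rw [hsO, hP0, hxO]; ring
        have h4 : sV = 0 := by rw [hsV, hP0, hxV]; ring
        rw [h3, h4, mul_zero, mul_zero]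
    · have hdqpos : 0 < dq := lt_of_le_of_ne (hn _) (Ne.symm hdq0)
      exact le_of_mul_le_mul_left e3 hdqpos
  -- assemble: `P·(want)` from `P·T1 + key + (1-P)(mb-ma)·T4`, then divide by `P` (or `P = 0`)
  have hT4' : dov * xV ≤ d * xO := hT4
  by_cases hP0 : P = 0
  · have hxO : xO = 0 := le_antisymm (hP0 ▸ measureReal_mono inter_subset_right (measure_ne_top _ _)) (hn _)
    have hxV : xV = 0 := le_antisymm (hP0 ▸ measureReal_mono inter_subset_right (measure_ne_top _ _)) (hn _)
    have hI0 : ∀ (k : BondConfig V → ℝ) (S : Set (BondConfig V)), μ.real (S ∩ Qc) = 0 → ∫ ω in S ∩ Qc, k ω ∂μ = 0 :=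
      fun k S h0 => setIntegral_measure_zero k ((measureReal_eq_zero_iff (measure_ne_top _ _)).1 h0)
    have h1 : IbO = 0 := hI0 fb _ hxO
    have h2 : IbV = 0 := hI0 fb _ hxV
    have h3 : JaO = 0 := hI0 fa _ hxO
    have h4 : JaV = 0 := hI0 fa _ hxV
    rw [h1, h2, hxO, hxV]
    rw [h3, h4, hxO, hxV] at hT1
    simp only [add_zero, zero_mul] at hT1 ⊢
    exact hT1
  · have hPpos : 0 < P := lt_of_le_of_ne (hn _) (Ne.symm hP0)
    have hc : 0 ≤ (1 - P) * (mb - ma) := mul_nonneg (by linarith) (by linarith)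
    have i1 : dov * (P * (IaV + JaV - (yV + xV) * ma)) ≤ d * (P * (IaO + JaO - (yO + xO) * ma)) :=
      calc dov * (P * (IaV + JaV - (yV + xV) * ma)) = P * (dov * (IaV + JaV - (yV + xV) * ma)) := by ring
        _ ≤ P * (d * (IaO + JaO - (yO + xO) * ma)) := mul_le_mul_of_nonneg_left hT1 (hn Qc)
        _ = d * (P * (IaO + JaO - (yO + xO) * ma)) := by ring
    have i3 : dov * ((1 - P) * (mb - ma) * xV) ≤ d * ((1 - P) * (mb - ma) * xO) :=
      calc dov * ((1 - P) * (mb - ma) * xV) = (1 - P) * (mb - ma) * (dov * xV) := by ring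
        _ ≤ (1 - P) * (mb - ma) * (d * xO) := mul_le_mul_of_nonneg_left hT4' hc
        _ = d * ((1 - P) * (mb - ma) * xO) := by ring
    have split : ∀ (Ia Ib Ja x y : ℝ), P * (Ia + Ib - (y * ma + x * mb)) =
        P * (Ia + Ja - (y + x) * ma) + (P * (Ib - Ja) - x * (mb - ma)) + (1 - P) * (mb - ma) * x := by
      intro Ia Ib Ja x y; ring
    have hfinal : P * (dov * (IaV + IbV - (yV * ma + xV * mb))) ≤ P * (d * (IaO + IbO - (yO * ma + xO * mb))) :=
      calc P * (dov * (IaV + IbV - (yV * ma + xV * mb))) = dov * (P * (IaV + IbV - (yV * ma + xV * mb))) := by ring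
        _ = dov * (P * (IaV + JaV - (yV + xV) * ma)) + dov * sV + dov * ((1 - P) * (mb - ma) * xV) := by
          rw [split IaV IbV JaV xV yV]; ring
        _ ≤ d * (P * (IaO + JaO - (yO + xO) * ma)) + d * sO + d * ((1 - P) * (mb - ma) * xO) := by
          linarith [i1, hkey, i3]
        _ = d * (P * (IaO + IbO - (yO * ma + xO * mb))) := by rw [split IaO IbO JaO xO yO]; ring
        _ = P * (d * (IaO + IbO - (yO * ma + xO * mb))) := by ring
    exact le_of_mul_le_mul_left hfinal hPpos


/-! ## Corollaries: (GEN) for three relays and Kozma–Nitzan's Conjecture 1 for three relays from (♠) -/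

/-- **(GEN) for three relays from the transfer (♠).**  For `F` monotone nonnegative, an observer `o` and relays `a₁, a₂, a₃` with
`m₁ ≤ m₂ ≤ m₃` (`m_i = ∫ F(C(a_i))`), `a₃ ≠ a₁, a₂`: IF the (+)-type piece transfers from `a₃` to `o` over `{a₁, a₂}` ((♠) with
`(a, b, v) = (a₁, a₂, a₃)`), THEN `μ(o↔a₁)·m₁ + μ(o↔a₂, o↮a₁)·m₂ + μ(o↔a₃, o↮a₁, o↮a₂)·m₃ ≤ ∫_{o ↔ {a₁,a₂,a₃}} F(C(o))`
(`surplusTransfer_pair_of_plusTransfer` + `AGloc.gen_triple_of_surplusTransfer_pair`). [cite: KozmaNitzan2024, Conj. 4 (p. 32)] -/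
theorem gen_triple_of_plusTransfer (w : Sym2 V → unitInterval) (o a₁ a₂ a₃ : V) (h31 : a₃ ≠ a₁) (h32 : a₃ ≠ a₂)
    (F : Set V → ℝ) (hF : ∀ S T : Set V, S ⊆ T → F S ≤ F T) (hF0 : ∀ S, 0 ≤ F S)
    (hm12 : ∫ ω, F (openCluster ω a₁) ∂(prodBernoulli w) ≤ ∫ ω, F (openCluster ω a₂) ∂(prodBernoulli w))
    (hm23 : ∫ ω, F (openCluster ω a₂) ∂(prodBernoulli w) ≤ ∫ ω, F (openCluster ω a₃) ∂(prodBernoulli w))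
    (hUT : (prodBernoulli w).real (({ω : BondConfig V | ¬ (openGraph ω).Reachable a₃ a₁} ∩ {ω | ¬ (openGraph ω).Reachable a₃ a₂}) ∩
              (openConn a₁ a₂)ᶜ ∩ openConn o a₃) *
        ((prodBernoulli w).real ((openConn a₁ a₂)ᶜ : Set (BondConfig V)) *
            ∫ ω in (openConn a₃ a₂ ∩ (openConn a₁ a₂)ᶜ : Set (BondConfig V)), (F (openCluster ω a₂) - F (openCluster ω a₁)) ∂(prodBernoulli w) -
          (prodBernoulli w).real (openConn a₃ a₂ ∩ (openConn a₁ a₂)ᶜ : Set (BondConfig V)) *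
            ∫ ω in ((openConn a₁ a₂)ᶜ : Set (BondConfig V)), (F (openCluster ω a₂) - F (openCluster ω a₁)) ∂(prodBernoulli w)) ≤
      (prodBernoulli w).real (({ω : BondConfig V | ¬ (openGraph ω).Reachable a₃ a₁} ∩ {ω | ¬ (openGraph ω).Reachable a₃ a₂}) ∩
              (openConn a₁ a₂)ᶜ) *
        ((prodBernoulli w).real ((openConn a₁ a₂)ᶜ : Set (BondConfig V)) *
            ∫ ω in (openConn o a₂ ∩ (openConn a₁ a₂)ᶜ : Set (BondConfig V)), (F (openCluster ω a₂) - F (openCluster ω a₁)) ∂(prodBernoulli w) -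
          (prodBernoulli w).real (openConn o a₂ ∩ (openConn a₁ a₂)ᶜ : Set (BondConfig V)) *
            ∫ ω in ((openConn a₁ a₂)ᶜ : Set (BondConfig V)), (F (openCluster ω a₂) - F (openCluster ω a₁)) ∂(prodBernoulli w))) :
    (prodBernoulli w).real (openConn o a₁) * ∫ ω, F (openCluster ω a₁) ∂(prodBernoulli w) +
        (prodBernoulli w).real (openConn o a₂ ∩ (openConn o a₁)ᶜ : Set (BondConfig V)) *
          ∫ ω, F (openCluster ω a₂) ∂(prodBernoulli w) +
        (prodBernoulli w).real (openConn o a₃ ∩ (openConn o a₁ ∪ openConn o a₂)ᶜ : Set (BondConfig V)) *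
          ∫ ω, F (openCluster ω a₃) ∂(prodBernoulli w) ≤
      ∫ ω in (openConn o a₁ ∪ openConn o a₂ ∪ openConn o a₃), F (openCluster ω o) ∂(prodBernoulli w) :=
  AGloc.gen_triple_of_surplusTransfer_pair w o a₁ a₂ a₃ h31 h32 F hF hF0 hm12 hm23
    (surplusTransfer_pair_of_plusTransfer w o a₃ a₁ a₂ h31 h32 F hF hF0 hm12 hUT)

/-- **Kozma–Nitzan's Conjecture 1 for three relays from (♠).**  Relays `a₁, a₂, a₃` labelled so that
`μ(a₁ ↔ b') ≤ μ(a₂ ↔ b') ≤ μ(a₃ ↔ b')` (`a₃ ≠ a₁, a₂`), target `b'`, observer `o`, `t ≤ μ(a_i ↔ b')` for all `i`: IF (♠) holds for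
`(a, b, v) = (a₁, a₂, a₃)` and `F = 1{b' ∈ ·}`, THEN `t · μ(o ↔ {a₁,a₂,a₃}) ≤ μ(o ↔ b')` — Conjecture 1 of Kozma–Nitzan for `|A| = 3`
(open in print), via (GEN) for `F = 1{b' ∈ ·}`: `Σ_i μ(P_i)·μ(a_i ↔ b') ≤ μ(o ↔ A, o ↔ b')`, the first-reached events `P_i` partitioning
`{o ↔ A}`. [cite: KozmaNitzan2024, Conjecture 1 (p. 3)] -/
theorem kn_conj1_three_of_plusTransfer (w : Sym2 V → unitInterval) (o b' a₁ a₂ a₃ : V) (h31 : a₃ ≠ a₁) (h32 : a₃ ≠ a₂)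
    (hm12 : (prodBernoulli w).real (openConn a₁ b') ≤ (prodBernoulli w).real (openConn a₂ b'))
    (hm23 : (prodBernoulli w).real (openConn a₂ b') ≤ (prodBernoulli w).real (openConn a₃ b'))
    (t : ℝ) (ht1 : t ≤ (prodBernoulli w).real (openConn a₁ b'))
    (hUT : (prodBernoulli w).real (({ω : BondConfig V | ¬ (openGraph ω).Reachable a₃ a₁} ∩ {ω | ¬ (openGraph ω).Reachable a₃ a₂}) ∩
              (openConn a₁ a₂)ᶜ ∩ openConn o a₃) *
        ((prodBernoulli w).real ((openConn a₁ a₂)ᶜ : Set (BondConfig V)) *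
            ((prodBernoulli w).real (openConn a₃ a₂ ∩ (openConn a₁ a₂)ᶜ ∩ openConn a₂ b' : Set (BondConfig V)) -
              (prodBernoulli w).real (openConn a₃ a₂ ∩ (openConn a₁ a₂)ᶜ ∩ openConn a₁ b' : Set (BondConfig V))) -
          (prodBernoulli w).real (openConn a₃ a₂ ∩ (openConn a₁ a₂)ᶜ : Set (BondConfig V)) *
            ((prodBernoulli w).real ((openConn a₁ a₂)ᶜ ∩ openConn a₂ b' : Set (BondConfig V)) -
              (prodBernoulli w).real ((openConn a₁ a₂)ᶜ ∩ openConn a₁ b' : Set (BondConfig V)))) ≤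
      (prodBernoulli w).real (({ω : BondConfig V | ¬ (openGraph ω).Reachable a₃ a₁} ∩ {ω | ¬ (openGraph ω).Reachable a₃ a₂}) ∩
              (openConn a₁ a₂)ᶜ) *
        ((prodBernoulli w).real ((openConn a₁ a₂)ᶜ : Set (BondConfig V)) *
            ((prodBernoulli w).real (openConn o a₂ ∩ (openConn a₁ a₂)ᶜ ∩ openConn a₂ b' : Set (BondConfig V)) -
              (prodBernoulli w).real (openConn o a₂ ∩ (openConn a₁ a₂)ᶜ ∩ openConn a₁ b' : Set (BondConfig V))) -
          (prodBernoulli w).real (openConn o a₂ ∩ (openConn a₁ a₂)ᶜ : Set (BondConfig V)) *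
            ((prodBernoulli w).real ((openConn a₁ a₂)ᶜ ∩ openConn a₂ b' : Set (BondConfig V)) -
              (prodBernoulli w).real ((openConn a₁ a₂)ᶜ ∩ openConn a₁ b' : Set (BondConfig V))))) :
    t * (prodBernoulli w).real (openConn o a₁ ∪ openConn o a₂ ∪ openConn o a₃ : Set (BondConfig V)) ≤
      (prodBernoulli w).real (openConn o b') := by
  classical
  set μ := prodBernoulli w with hμ
  have hmeas : ∀ S : Set (BondConfig V), MeasurableSet S := fun _ => MeasurableSet.of_discrete
  have hn := fun (S : Set (BondConfig V)) => (measureReal_nonneg : 0 ≤ μ.real S)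
  -- the set function `F = 1{b' ∈ ·}`
  set F : Set V → ℝ := fun M => if b' ∈ M then 1 else 0 with hF
  have hFmono : ∀ S T : Set V, S ⊆ T → F S ≤ F T := by
    intro S T hST
    simp only [hF]
    by_cases hS : b' ∈ S
    · rw [if_pos hS, if_pos (hST hS)]
    · rw [if_neg hS]
      split_ifs <;> norm_num
  have hF0 : ∀ S, 0 ≤ F S := by
    intro S
    simp only [hF]
    split_ifs <;> norm_num
  have hFind : ∀ x : V, (fun ω : BondConfig V => F (openCluster ω x)) = (openConn x b' : Set (BondConfig V)).indicator 1 := by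
    intro x
    funext ω
    simp only [hF]
    by_cases hω : ω ∈ (openConn x b' : Set (BondConfig V))
    · rw [Set.indicator_of_mem hω, Pi.one_apply, if_pos (show b' ∈ openCluster ω x from hω)]
    · rw [Set.indicator_of_notMem hω, if_neg (show b' ∉ openCluster ω x from hω)]
  have hint : ∀ x : V, ∫ ω, F (openCluster ω x) ∂μ = μ.real (openConn x b') := by
    intro x
    rw [hFind x, integral_indicator_one (hmeas _)]
  have hsetint : ∀ (x : V) (S : Set (BondConfig V)), ∫ ω in S, F (openCluster ω x) ∂μ = μ.real (S ∩ openConn x b' : Set (BondConfig V)) := by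
    intro x S
    rw [hFind x, ← integral_indicator (hmeas _), Set.indicator_indicator, integral_indicator_one ((hmeas _).inter (hmeas _))]
  have hsub : ∀ (S : Set (BondConfig V)), ∫ ω in S, (F (openCluster ω a₂) - F (openCluster ω a₁)) ∂μ =
      μ.real (S ∩ openConn a₂ b' : Set (BondConfig V)) - μ.real (S ∩ openConn a₁ b' : Set (BondConfig V)) := by
    intro S
    rw [integral_sub (Integrable.of_finite).integrableOn (Integrable.of_finite).integrableOn, hsetint, hsetint]
  have key := gen_triple_of_plusTransfer w o a₁ a₂ a₃ h31 h32 F hFmono hF0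
    (by rw [hint, hint]; exact hm12) (by rw [hint, hint]; exact hm23)
    (by rw [hsub, hsub, hsub]; exact hUT)
  rw [hint, hint, hint, hsetint] at key
  -- `Σ μ(P_i) = μ(U)` and `t ≤ m_i`
  set U : Set (BondConfig V) := openConn o a₁ ∪ openConn o a₂ ∪ openConn o a₃ with hU
  have hP : μ.real U = μ.real (openConn o a₁) + μ.real (openConn o a₂ ∩ (openConn o a₁)ᶜ : Set (BondConfig V)) +
      μ.real (openConn o a₃ ∩ (openConn o a₁ ∪ openConn o a₂)ᶜ : Set (BondConfig V)) := by
    have h1 : μ.real U = μ.real (U ∩ (openConn o a₁ ∪ openConn o a₂)) + μ.real (U \ (openConn o a₁ ∪ openConn o a₂)) :=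
      (measureReal_inter_add_sdiff (s := U) (h := measure_ne_top _ _) ((hmeas _).union (hmeas _))).symm
    have h2 : μ.real (openConn o a₁ ∪ openConn o a₂ : Set (BondConfig V)) =
        μ.real ((openConn o a₁ ∪ openConn o a₂ : Set (BondConfig V)) ∩ openConn o a₁) +
          μ.real ((openConn o a₁ ∪ openConn o a₂ : Set (BondConfig V)) \ openConn o a₁) :=
      (measureReal_inter_add_sdiff (s := (openConn o a₁ ∪ openConn o a₂ : Set (BondConfig V))) (h := measure_ne_top _ _) (hmeas _)).symm
    rw [inter_eq_right.2 subset_union_left, hU, Set.union_sdiff_left, Set.sdiff_eq] at h1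
    rw [inter_eq_right.2 subset_union_left, Set.union_sdiff_left, Set.sdiff_eq] at h2
    rw [hU, h1, h2]
  have ht2 : t ≤ μ.real (openConn a₂ b') := ht1.trans hm12
  have ht3 : t ≤ μ.real (openConn a₃ b') := ht2.trans hm23
  have hmono : μ.real (U ∩ openConn o b' : Set (BondConfig V)) ≤ μ.real (openConn o b') :=
    measureReal_mono inter_subset_right (measure_ne_top _ _)
  rw [hP]
  nlinarith [key, hmono, hn (openConn o a₁), hn (openConn o a₂ ∩ (openConn o a₁)ᶜ),
    hn (openConn o a₃ ∩ (openConn o a₁ ∪ openConn o a₂)ᶜ),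
    mul_le_mul_of_nonneg_right ht1 (hn (openConn o a₁)),
    mul_le_mul_of_nonneg_right ht2 (hn (openConn o a₂ ∩ (openConn o a₁)ᶜ)),
    mul_le_mul_of_nonneg_right ht3 (hn (openConn o a₃ ∩ (openConn o a₁ ∪ openConn o a₂)ᶜ))]

end Measure

end Summit.CriticalPhenomena.PercolationContinuityZ3.Theorems.SurplusTransfer

end
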